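import Summits.HodgeConjecture.CorCM.IrreducibleOddWeightsIsotypicExistence
import Summits.HodgeConjecture.CorCM.IrreducibleOddWeightsMultiClassRankCMFields
import HarnessLib

/-!
# Isotypic cells, existence IV: THE MULTI-CLASS FORMULAS WITH NO INPUT BUT THE TYPES — for EVERY family of CM
# types there is an isotypic decomposition of the type vectors for which `dim Hg(∏_i A_i) = Σ_c r_c·dim A_c`,
# `Hg(∏_i A_i) = ∏_i Hg(A_i) ⟺` the D-spans are independent class by class, and sub-family domination `⟺`
# D-span containment class by class

COR-CM (cell `pub-hodgecm2`, binder seat `b16` gen 76, count-neutral claim THE ISOTYPIC DECOMPOSITION EXISTS, file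
E4 — type ranks and the CM dress; theorems only, no definition, no named fact, no `sorry`).  NEW as stated, hence
under `Summits/`.  HONEST FRAMING: gen 75's files M5 / M5-CM (`…MultiClassRank{,CMFields}`) prove the multiplicity
formula, the additivity criterion and the sub-family domination criterion for a family of CM types `Φ_i` GIVEN an
isotypic decomposition of the type vectors `u_i` (references `A_c`, commutants `𝒟_c`, embeddings `ι^i_{c,j}`,
components `b^i_{c,j}` — «the census side supplies it»).  File E3 proved that such a decomposition EXISTS for every
family of slots.  This file discharges the input: each statement below quantifies only over the types and ASSERTS
the existence of a decomposition together with the formula / criterion it satisfies.  `rank Σ − 1 = dim Hg(∏_i A_i)`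
and `cmFamilyRank Φ = dim MT(∏_i A_i)` are the tree's dictionary; nothing about the algebraicity of Hodge classes is
asserted; `HC_CM` is neither used nor asserted.

THE DATA ASSERTED TO EXIST (in every statement; `V = ℚ^{⊔_i E_i}`): `n`; references `A_c ≤ V` (`c ∈ Fin n`) STABLE,
IRREDUCIBLE, NON-ZERO, PAIRWISE NON-EMBEDDABLE; their commutants `𝒟_c ≤ End V` (`L ∈ 𝒟_c ⟺ L(A_c) ⊆ A_c` and `L`
commutes with the translates on `A_c`); multiplicities `m_{i,c}`; embeddings `ι^i_{c,j} : V → ℚ^{E_i}`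
(`j ∈ Fin m_{i,c}`) EQUIVARIANT and JOINTLY INDEPENDENT on `A_c`; components `b^i_{c,j} ∈ A_c` with
`u_i = Σ_c Σ_j ι^i_{c,j}(b^i_{c,j})`; non-zero `a₀_c ∈ A_c` (so `δ_c = dim 𝒟_c·a₀_c`).

* §1 `exists_isotypic_decomposition_antiVec` — ALL hypotheses `h𝒟 hRst hRirr hR0 hsep hιeq hind hb hu ha₀ h0` of the
  multi-class files, packaged for the type vectors `u_i = antiVec (Φ i) 1` of any family of sets `Φ_i ⊆ E_i`.
* §2 TYPE RANKS: **`exists_isotypic_typeRank_sigmaType_eq_sum`** (`∃` data and `r_c ≤ Σ_i m_{i,c}` with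
  `dim ⨆_{i,j} 𝒟_c·b^i_{c,j} = r_c·δ_c` and **`rank Σ = Σ_c r_c·dim A_c + 1`**);
  **`exists_isotypic_typeRank_sigmaType_add_card_eq_iff`** (`∃` data with **`rank Σ + |I| = Σ_i rank Φ_i + 1 ⟺ ∀ c`,
  the D-spans `(⨆_j 𝒟_c·b^i_{c,j})_i` are INDEPENDENT**); **`exists_isotypic_typeRank_sigmaType_eq_reindex_iff`**
  (`κ : I′ → I`: **`rank Σ = rank Σ_κ ⟺ ∀ c ∀ i, ⨆_j 𝒟_c·b^i_{c,j} ≤ ⨆_{j′} ⨆_j 𝒟_c·b^{κ j′}_{c,j}`**).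
* §3 CM FIELDS (`G = Aut(ℂ)`, `E_i = Hom(K_i, ℂ)`): **`exists_isotypic_cmFamilyRank_eq_sum`**
  (`dim MT(∏_i A_i) = Σ_c r_c·dim A_c + 1`), **`exists_isotypic_cmFamilyRank_add_card_eq_iff`**
  (`Hg(∏_i A_i) = ∏_i Hg(A_i) ⟺` independent D-spans class by class),
  **`exists_isotypic_cmFamilyRank_eq_restrict_iff`** (`T ⊆ I` non-empty: `dim MT(∏_I A_i) = dim MT(∏_T A_i) ⟺`
  D-span containment class by class).

## References

* [Deligne1982HodgeCycles] P. Deligne, *Hodge cycles on abelian varieties*, LNM 900 (1982), I.5 (p. 53), I Ex. 3.7.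
* [Serre1977] J.-P. Serre, *Linear Representations of Finite Groups*, GTM 42, §1.4 Thm. 2, §2.6.
* [Gordon1999HodgeAVSurvey] B. B. Gordon, *A survey of the Hodge conjecture for abelian varieties*, §3 Theorem (Imai,
  Murty) with proof, 7.5–7.7, 9.4.3.
* [Lang2002] S. Lang, *Algebra*, 3rd ed., XVII §1–§3.
* [Mai1989] L. Mai, *Lower bounds for the ranks of CM types*, J. Number Theory 32 (1989), §2 Prop. 1 (proof).
-/

set_option autoImplicit false

noncomputable section

open scoped BigOperators Classical

universe u u' v w

namespace Summit.HodgeConjecture.CorCM.IrrOdd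

open Literature.NumberTheory.ComplexMultiplication

variable {G : Type w} [Group G] {I : Type u} {E : I → Type v} [∀ i, MulAction G (E i)] [∀ i, Fintype (E i)]
  [Fintype I]

/-! ### §1 All hypotheses of the multi-class files, packaged -/

/-- **THE ISOTYPIC DECOMPOSITION OF THE TYPE VECTORS EXISTS, WITH COMMUTANTS AND BASE VECTORS**: for any sets
`Φ_i ⊆ E_i` the type vectors `u_i = antiVec Φ_i 1` admit references `A_c`, commutants `𝒟_c`, multiplicities
`m_{i,c}`, embeddings `ι^i_{c,j}`, components `b^i_{c,j}` and non-zero `a₀_c ∈ A_c` satisfying ALL the hypotheses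
`h𝒟`, `hRst`, `hRirr`, `hR0`, `hsep`, `hιeq`, `hind`, `hb`, `hu`, `ha₀`, `h0` of the multi-class files M1–M9 (file E3
`exists_isotypic_decomposition` + gen 72 C1 `exists_commutant`). [cite: Serre1977, §1.4 Thm. 2 and §2.6]
[cite: Lang2002, XVII §1 Prop. 1.1 and XVII §2] -/
theorem exists_isotypic_decomposition_antiVec (Φ : ∀ i, Set (E i)) :
    ∃ (n : ℕ) (Ar : Fin n → Submodule ℚ ((Σ i, E i) → ℚ))
      (𝒟 : Fin n → Submodule ℚ (((Σ i, E i) → ℚ) →ₗ[ℚ] ((Σ i, E i) → ℚ))) (m : I → Fin n → ℕ)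
      (ι : ∀ (i : I) (c : Fin n), Fin (m i c) → (((Σ i, E i) → ℚ) →ₗ[ℚ] (E i → ℚ)))
      (b : ∀ (i : I) (c : Fin n), Fin (m i c) → ((Σ i, E i) → ℚ)) (a₀ : Fin n → ((Σ i, E i) → ℚ)),
      (∀ (c : Fin n) (L : ((Σ i, E i) → ℚ) →ₗ[ℚ] ((Σ i, E i) → ℚ)), L ∈ 𝒟 c ↔ (∀ a ∈ Ar c, L a ∈ Ar c) ∧
        ∀ (k : G) (a : (Σ i, E i) → ℚ), a ∈ Ar c → L (fun x => a (k • x)) = fun x => L a (k • x)) ∧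
      (∀ (c : Fin n) (k : G) (a : (Σ i, E i) → ℚ), a ∈ Ar c → (fun x => a (k • x)) ∈ Ar c) ∧
      (∀ (c : Fin n) (W : Submodule ℚ ((Σ i, E i) → ℚ)), W ≤ Ar c → W ≠ ⊥ →
        (∀ (k : G) (f : (Σ i, E i) → ℚ), f ∈ W → (fun x => f (k • x)) ∈ W) → W = Ar c) ∧
      (∀ c : Fin n, Ar c ≠ ⊥) ∧
      (∀ (c c' : Fin n) (L : ((Σ i, E i) → ℚ) →ₗ[ℚ] ((Σ i, E i) → ℚ)), c ≠ c' → Ar c ≠ ⊥ →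
        (∀ a ∈ Ar c, L a ∈ Ar c') → (∀ a ∈ Ar c, L a = 0 → a = 0) →
        (∀ (k : G) (a : (Σ i, E i) → ℚ), a ∈ Ar c → L (fun x => a (k • x)) = fun x => L a (k • x)) →
        False) ∧
      (∀ (i : I) (c : Fin n) (j : Fin (m i c)) (k : G) (a : (Σ i, E i) → ℚ), a ∈ Ar c →
        ι i c j (fun x => a (k • x)) = fun s => ι i c j a (k • s)) ∧
      (∀ (i : I) (c : Fin n) (f : Fin (m i c) → ((Σ i, E i) → ℚ)), (∀ j, f j ∈ Ar c) →
        ∑ j, ι i c j (f j) = 0 → ∀ j, f j = 0) ∧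
      (∀ i c j, b i c j ∈ Ar c) ∧
      (∀ i, antiVec (Φ i) (1 : G) = ∑ c, ∑ j, ι i c j (b i c j)) ∧
      (∀ c, a₀ c ∈ Ar c) ∧ ∀ c, a₀ c ≠ 0 := by
  obtain ⟨n, Ar, m, ι, hRst, hRirr, hR0, hsep, hιeq, hind, -, -, hdec⟩ :=
    exists_isotypic_decomposition (G := G) (E := E)
  obtain ⟨𝒟, h𝒟⟩ := exists_commutants (G := G) Ar
  obtain ⟨a₀, ha₀, h0⟩ := exists_mem_ne_zero_of_forall_ne_bot hR0
  obtain ⟨b, hb, hu⟩ := hdec fun i => antiVec (Φ i) (1 : G)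
  exact ⟨n, Ar, 𝒟, m, ι, b, a₀, h𝒟, hRst, hRirr, hR0, hsep, hιeq, hind, hb, hu, ha₀, h0⟩

/-! ### §2 Type ranks with no input but the types -/

variable [∀ i, Nonempty (E i)]

/-- **THE MULTIPLICITY FORMULA WITH NO INPUT BUT THE TYPES: `rank Σ = Σ_c r_c·dim A_c + 1`** — for every family of CM
types `Φ_i` there is an isotypic decomposition of the type vectors (references `A_c` stable irreducible non-zero
pairwise non-embeddable, commutants `𝒟_c`, equivariant jointly independent embeddings `ι^i_{c,j}`, components
`b^i_{c,j} ∈ A_c` with `u_i = Σ ι(b)`, non-zero `a₀_c ∈ A_c`) and `r_c ≤ Σ_i m_{i,c}` with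
`dim ⨆_{i,j} 𝒟_c·b^i_{c,j} = r_c·dim 𝒟_c·a₀_c` and `rank Σ = Σ_c r_c·dim A_c + 1` (`dim Hg(∏_i A_i) =
Σ_c r_c·dim A_c`; gen 75 M5 + file E3). [cite: Deligne1982HodgeCycles, I.5 (p. 53) and I Ex. 3.7 (c)]
[cite: Serre1977, §2.6] [cite: Mai1989, §2 Prop. 1 (proof)] -/
theorem exists_isotypic_typeRank_sigmaType_eq_sum [Nonempty I] {ρ : G} {Φ : ∀ i, Set (E i)}
    (h : ∀ i, IsCMTypeWith ρ (Φ i)) :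
    ∃ (n : ℕ) (Ar : Fin n → Submodule ℚ ((Σ i, E i) → ℚ))
      (𝒟 : Fin n → Submodule ℚ (((Σ i, E i) → ℚ) →ₗ[ℚ] ((Σ i, E i) → ℚ))) (m : I → Fin n → ℕ)
      (ι : ∀ (i : I) (c : Fin n), Fin (m i c) → (((Σ i, E i) → ℚ) →ₗ[ℚ] (E i → ℚ)))
      (b : ∀ (i : I) (c : Fin n), Fin (m i c) → ((Σ i, E i) → ℚ)) (a₀ : Fin n → ((Σ i, E i) → ℚ))
      (r : Fin n → ℕ),
      (∀ (c : Fin n) (L : ((Σ i, E i) → ℚ) →ₗ[ℚ] ((Σ i, E i) → ℚ)), L ∈ 𝒟 c ↔ (∀ a ∈ Ar c, L a ∈ Ar c) ∧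
        ∀ (k : G) (a : (Σ i, E i) → ℚ), a ∈ Ar c → L (fun x => a (k • x)) = fun x => L a (k • x)) ∧
      (∀ (c : Fin n) (k : G) (a : (Σ i, E i) → ℚ), a ∈ Ar c → (fun x => a (k • x)) ∈ Ar c) ∧
      (∀ (c : Fin n) (W : Submodule ℚ ((Σ i, E i) → ℚ)), W ≤ Ar c → W ≠ ⊥ →
        (∀ (k : G) (f : (Σ i, E i) → ℚ), f ∈ W → (fun x => f (k • x)) ∈ W) → W = Ar c) ∧
      (∀ c : Fin n, Ar c ≠ ⊥) ∧
      (∀ (c c' : Fin n) (L : ((Σ i, E i) → ℚ) →ₗ[ℚ] ((Σ i, E i) → ℚ)), c ≠ c' → Ar c ≠ ⊥ →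
        (∀ a ∈ Ar c, L a ∈ Ar c') → (∀ a ∈ Ar c, L a = 0 → a = 0) →
        (∀ (k : G) (a : (Σ i, E i) → ℚ), a ∈ Ar c → L (fun x => a (k • x)) = fun x => L a (k • x)) →
        False) ∧
      (∀ (i : I) (c : Fin n) (j : Fin (m i c)) (k : G) (a : (Σ i, E i) → ℚ), a ∈ Ar c →
        ι i c j (fun x => a (k • x)) = fun s => ι i c j a (k • s)) ∧
      (∀ (i : I) (c : Fin n) (f : Fin (m i c) → ((Σ i, E i) → ℚ)), (∀ j, f j ∈ Ar c) →
        ∑ j, ι i c j (f j) = 0 → ∀ j, f j = 0) ∧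
      (∀ i c j, b i c j ∈ Ar c) ∧ (∀ i, antiVec (Φ i) (1 : G) = ∑ c, ∑ j, ι i c j (b i c j)) ∧
      (∀ c, a₀ c ∈ Ar c) ∧ (∀ c, a₀ c ≠ 0) ∧
      (∀ c, r c ≤ ∑ i, m i c) ∧
      (∀ c, Module.finrank ℚ ↥(⨆ i, ⨆ j, (𝒟 c).map (LinearMap.applyₗ (b i c j))) =
        r c * Module.finrank ℚ ↥((𝒟 c).map (LinearMap.applyₗ (a₀ c)))) ∧
      typeRank G (sigmaType Φ) = (∑ c, r c * Module.finrank ℚ (Ar c)) + 1 := by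
  obtain ⟨n, Ar, 𝒟, m, ι, b, a₀, h𝒟, hRst, hRirr, hR0, hsep, hιeq, hind, hb, hu, ha₀, h0⟩ :=
    exists_isotypic_decomposition_antiVec (G := G) Φ
  obtain ⟨r, hr, hD, hS⟩ := exists_rank_typeRank_sigmaType_eq_sum_of_classes (Yc := fun _ : Fin n => Σ i, E i)
    (JJ := fun i c => Fin (m i c)) h h𝒟 hRst hRirr hsep ι hιeq hind hb hu ha₀ h0
  refine ⟨n, Ar, 𝒟, m, ι, b, a₀, r, h𝒟, hRst, hRirr, hR0, hsep, hιeq, hind, hb, hu, ha₀, h0, fun c => ?_, hD, hS⟩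
  have h1 := hr c
  simp only [Fintype.card_fin] at h1
  exact h1

/-- **THE ADDITIVITY CRITERION WITH NO INPUT BUT THE TYPES: `Hg(∏_i A_i) = ∏_i Hg(A_i)` (`rank Σ + |I| =
Σ_i rank Φ_i + 1`) IFF, for an isotypic decomposition of the type vectors (which EXISTS, file E3), in EVERY class
`c` the D-spans `⨆_j 𝒟_c·b^i_{c,j}` (`i ∈ I`) are INDEPENDENT in `A_c`** (gen 75 M5 + file E3).
[cite: Gordon1999HodgeAVSurvey, §3 Theorem and 7.5–7.7] [cite: Deligne1982HodgeCycles, I.5 (p. 53)]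
[cite: Lang2002, XVII §1 and §3] -/
theorem exists_isotypic_typeRank_sigmaType_add_card_eq_iff [Nonempty I] {ρ : G} {Φ : ∀ i, Set (E i)}
    (h : ∀ i, IsCMTypeWith ρ (Φ i)) :
    ∃ (n : ℕ) (Ar : Fin n → Submodule ℚ ((Σ i, E i) → ℚ))
      (𝒟 : Fin n → Submodule ℚ (((Σ i, E i) → ℚ) →ₗ[ℚ] ((Σ i, E i) → ℚ))) (m : I → Fin n → ℕ)
      (ι : ∀ (i : I) (c : Fin n), Fin (m i c) → (((Σ i, E i) → ℚ) →ₗ[ℚ] (E i → ℚ)))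
      (b : ∀ (i : I) (c : Fin n), Fin (m i c) → ((Σ i, E i) → ℚ)),
      (∀ (c : Fin n) (L : ((Σ i, E i) → ℚ) →ₗ[ℚ] ((Σ i, E i) → ℚ)), L ∈ 𝒟 c ↔ (∀ a ∈ Ar c, L a ∈ Ar c) ∧
        ∀ (k : G) (a : (Σ i, E i) → ℚ), a ∈ Ar c → L (fun x => a (k • x)) = fun x => L a (k • x)) ∧
      (∀ (c : Fin n) (k : G) (a : (Σ i, E i) → ℚ), a ∈ Ar c → (fun x => a (k • x)) ∈ Ar c) ∧
      (∀ (c : Fin n) (W : Submodule ℚ ((Σ i, E i) → ℚ)), W ≤ Ar c → W ≠ ⊥ →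
        (∀ (k : G) (f : (Σ i, E i) → ℚ), f ∈ W → (fun x => f (k • x)) ∈ W) → W = Ar c) ∧
      (∀ c : Fin n, Ar c ≠ ⊥) ∧
      (∀ (c c' : Fin n) (L : ((Σ i, E i) → ℚ) →ₗ[ℚ] ((Σ i, E i) → ℚ)), c ≠ c' → Ar c ≠ ⊥ →
        (∀ a ∈ Ar c, L a ∈ Ar c') → (∀ a ∈ Ar c, L a = 0 → a = 0) →
        (∀ (k : G) (a : (Σ i, E i) → ℚ), a ∈ Ar c → L (fun x => a (k • x)) = fun x => L a (k • x)) →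
        False) ∧
      (∀ (i : I) (c : Fin n) (j : Fin (m i c)) (k : G) (a : (Σ i, E i) → ℚ), a ∈ Ar c →
        ι i c j (fun x => a (k • x)) = fun s => ι i c j a (k • s)) ∧
      (∀ (i : I) (c : Fin n) (f : Fin (m i c) → ((Σ i, E i) → ℚ)), (∀ j, f j ∈ Ar c) →
        ∑ j, ι i c j (f j) = 0 → ∀ j, f j = 0) ∧
      (∀ i c j, b i c j ∈ Ar c) ∧ (∀ i, antiVec (Φ i) (1 : G) = ∑ c, ∑ j, ι i c j (b i c j)) ∧
      (typeRank G (sigmaType Φ) + Fintype.card I = (∑ i, typeRank G (Φ i)) + 1 ↔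
        ∀ c, iSupIndep fun i => ⨆ j, (𝒟 c).map (LinearMap.applyₗ (b i c j))) := by
  obtain ⟨n, Ar, 𝒟, m, ι, b, a₀, h𝒟, hRst, hRirr, hR0, hsep, hιeq, hind, hb, hu, -, -⟩ :=
    exists_isotypic_decomposition_antiVec (G := G) Φ
  exact ⟨n, Ar, 𝒟, m, ι, b, h𝒟, hRst, hRirr, hR0, hsep, hιeq, hind, hb, hu,
    typeRank_sigmaType_add_card_eq_iff_forall_iSupIndep_of_classes (Yc := fun _ : Fin n => Σ i, E i)
      (JJ := fun i c => Fin (m i c)) h h𝒟 hRst hRirr hR0 hsep ι hιeq hind hb hu⟩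

/-- **THE SUB-FAMILY DOMINATION CRITERION WITH NO INPUT BUT THE TYPES** (`κ : I′ → I`, `I′` non-empty): for an
isotypic decomposition of the type vectors (which EXISTS), **`rank Σ = rank Σ_κ ⟺ ∀ c ∀ i, ⨆_j 𝒟_c·b^i_{c,j} ≤
⨆_{j′} ⨆_j 𝒟_c·b^{κ j′}_{c,j}`** — the sub-product `∏_{I′} A_{κ j′}` carries the whole Hodge theory of `∏_I A_i`
iff, class by class, every member's components are `𝒟_c`-combinations of the kept ones (gen 75 M5 + file E3).
[cite: Deligne1982HodgeCycles, I.5 (p. 53)] [cite: Gordon1999HodgeAVSurvey, 7.5–7.7] [cite: Lang2002, XVII §3] -/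
theorem exists_isotypic_typeRank_sigmaType_eq_reindex_iff {ρ : G} {Φ : ∀ i, Set (E i)}
    (h : ∀ i, IsCMTypeWith ρ (Φ i)) {I' : Type u'} [Fintype I'] [Nonempty I'] (κ : I' → I) :
    ∃ (n : ℕ) (Ar : Fin n → Submodule ℚ ((Σ i, E i) → ℚ))
      (𝒟 : Fin n → Submodule ℚ (((Σ i, E i) → ℚ) →ₗ[ℚ] ((Σ i, E i) → ℚ))) (m : I → Fin n → ℕ)
      (ι : ∀ (i : I) (c : Fin n), Fin (m i c) → (((Σ i, E i) → ℚ) →ₗ[ℚ] (E i → ℚ)))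
      (b : ∀ (i : I) (c : Fin n), Fin (m i c) → ((Σ i, E i) → ℚ)),
      (∀ (c : Fin n) (L : ((Σ i, E i) → ℚ) →ₗ[ℚ] ((Σ i, E i) → ℚ)), L ∈ 𝒟 c ↔ (∀ a ∈ Ar c, L a ∈ Ar c) ∧
        ∀ (k : G) (a : (Σ i, E i) → ℚ), a ∈ Ar c → L (fun x => a (k • x)) = fun x => L a (k • x)) ∧
      (∀ (c : Fin n) (k : G) (a : (Σ i, E i) → ℚ), a ∈ Ar c → (fun x => a (k • x)) ∈ Ar c) ∧
      (∀ (c : Fin n) (W : Submodule ℚ ((Σ i, E i) → ℚ)), W ≤ Ar c → W ≠ ⊥ →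
        (∀ (k : G) (f : (Σ i, E i) → ℚ), f ∈ W → (fun x => f (k • x)) ∈ W) → W = Ar c) ∧
      (∀ c : Fin n, Ar c ≠ ⊥) ∧
      (∀ (c c' : Fin n) (L : ((Σ i, E i) → ℚ) →ₗ[ℚ] ((Σ i, E i) → ℚ)), c ≠ c' → Ar c ≠ ⊥ →
        (∀ a ∈ Ar c, L a ∈ Ar c') → (∀ a ∈ Ar c, L a = 0 → a = 0) →
        (∀ (k : G) (a : (Σ i, E i) → ℚ), a ∈ Ar c → L (fun x => a (k • x)) = fun x => L a (k • x)) →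
        False) ∧
      (∀ (i : I) (c : Fin n) (j : Fin (m i c)) (k : G) (a : (Σ i, E i) → ℚ), a ∈ Ar c →
        ι i c j (fun x => a (k • x)) = fun s => ι i c j a (k • s)) ∧
      (∀ (i : I) (c : Fin n) (f : Fin (m i c) → ((Σ i, E i) → ℚ)), (∀ j, f j ∈ Ar c) →
        ∑ j, ι i c j (f j) = 0 → ∀ j, f j = 0) ∧
      (∀ i c j, b i c j ∈ Ar c) ∧ (∀ i, antiVec (Φ i) (1 : G) = ∑ c, ∑ j, ι i c j (b i c j)) ∧
      (typeRank G (sigmaType Φ) = typeRank G (sigmaType fun j => Φ (κ j)) ↔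
        ∀ c i, (⨆ j, (𝒟 c).map (LinearMap.applyₗ (b i c j))) ≤
          ⨆ j', ⨆ j, (𝒟 c).map (LinearMap.applyₗ (b (κ j') c j))) := by
  obtain ⟨n, Ar, 𝒟, m, ι, b, a₀, h𝒟, hRst, hRirr, hR0, hsep, hιeq, hind, hb, hu, -, -⟩ :=
    exists_isotypic_decomposition_antiVec (G := G) Φ
  exact ⟨n, Ar, 𝒟, m, ι, b, h𝒟, hRst, hRirr, hR0, hsep, hιeq, hind, hb, hu,
    typeRank_sigmaType_eq_reindex_iff_forall_iSup_le_of_classes (Yc := fun _ : Fin n => Σ i, E i)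
      (JJ := fun i c => Fin (m i c)) h κ h𝒟 hRst hRirr hR0 hsep ι hιeq hind hb hu⟩

end Summit.HodgeConjecture.CorCM.IrrOdd

/-! ### §3 Products of CM abelian varieties -/

namespace Summit.HodgeConjecture.CorCM

open CategoryTheory CategoryTheory.Limits NumberField Module IntermediateField
open Literature.NumberTheory.ComplexMultiplication
open Literature.AlgebraicGeometry.Motives (AbelianVariety CMType)
open Literature.AlgebraicGeometry.Motives.AbelianVariety
open Literature.AlgebraicGeometry.HodgeTheory
open Literature.AlgebraicGeometry.ComplexMultiplication (IsCMTypeRealisation)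
open Literature.AlgebraicGeometry.Pohlmann1968

variable {I : Type} [Fintype I] {K : I → Type} [∀ i, Field (K i)] [∀ i, NumberField (K i)] [∀ i, IsCMField (K i)]

/-- **`dim MT(∏_i A_i) = Σ_c r_c·dim A_c + 1` FOR EVERY PRODUCT OF CM ABELIAN VARIETIES, WITH NO INPUT BUT THE CM
TYPES**: there is an isotypic decomposition of the type vectors of the `Φ_i` over pairwise non-embeddable
`Aut(ℂ)`-stable irreducibles `A_c ≤ ℚ^{⊔_i Hom(K_i, ℂ)}` (commutants `𝒟_c`, equivariant jointly independent
embeddings, components `b^i_{c,j} ∈ A_c`, non-zero `a₀_c ∈ A_c`) and `r_c ≤ Σ_i m_{i,c}` with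
`dim ⨆_{i,j} 𝒟_c·b^i_{c,j} = r_c·dim 𝒟_c·a₀_c` and **`cmFamilyRank Φ = Σ_c r_c·dim A_c + 1`** (`dim Hg(∏_i A_i) =
Σ_c r_c·dim A_c`; gen 75 M5-CM + file E3). [cite: Deligne1982HodgeCycles, I.5 (p. 53) and I Ex. 3.7 (c)]
[cite: Serre1977, §2.6] [cite: Lang2002, XVII §3] -/
theorem exists_isotypic_cmFamilyRank_eq_sum [Nonempty I] (Φ : ∀ i, CMType (K i)) :
    ∃ (n : ℕ) (Ar : Fin n → Submodule ℚ ((Σ i, (K i →+* ℂ)) → ℚ))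
      (𝒟 : Fin n → Submodule ℚ (((Σ i, (K i →+* ℂ)) → ℚ) →ₗ[ℚ] ((Σ i, (K i →+* ℂ)) → ℚ)))
      (m : I → Fin n → ℕ)
      (ι : ∀ (i : I) (c : Fin n), Fin (m i c) → (((Σ i, (K i →+* ℂ)) → ℚ) →ₗ[ℚ] ((K i →+* ℂ) → ℚ)))
      (b : ∀ (i : I) (c : Fin n), Fin (m i c) → ((Σ i, (K i →+* ℂ)) → ℚ))
      (a₀ : Fin n → ((Σ i, (K i →+* ℂ)) → ℚ)) (r : Fin n → ℕ),
      (∀ (c : Fin n) (L : ((Σ i, (K i →+* ℂ)) → ℚ) →ₗ[ℚ] ((Σ i, (K i →+* ℂ)) → ℚ)), L ∈ 𝒟 c ↔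
        (∀ a ∈ Ar c, L a ∈ Ar c) ∧ ∀ (k : ℂ ≃+* ℂ) (a : (Σ i, (K i →+* ℂ)) → ℚ), a ∈ Ar c →
          L (fun x => a (k • x)) = fun x => L a (k • x)) ∧
      (∀ (c : Fin n) (k : ℂ ≃+* ℂ) (a : (Σ i, (K i →+* ℂ)) → ℚ), a ∈ Ar c → (fun x => a (k • x)) ∈ Ar c) ∧
      (∀ (c : Fin n) (W : Submodule ℚ ((Σ i, (K i →+* ℂ)) → ℚ)), W ≤ Ar c → W ≠ ⊥ →
        (∀ (k : ℂ ≃+* ℂ) (f : (Σ i, (K i →+* ℂ)) → ℚ), f ∈ W → (fun x => f (k • x)) ∈ W) → W = Ar c) ∧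
      (∀ c : Fin n, Ar c ≠ ⊥) ∧
      (∀ (c c' : Fin n) (L : ((Σ i, (K i →+* ℂ)) → ℚ) →ₗ[ℚ] ((Σ i, (K i →+* ℂ)) → ℚ)), c ≠ c' → Ar c ≠ ⊥ →
        (∀ a ∈ Ar c, L a ∈ Ar c') → (∀ a ∈ Ar c, L a = 0 → a = 0) →
        (∀ (k : ℂ ≃+* ℂ) (a : (Σ i, (K i →+* ℂ)) → ℚ), a ∈ Ar c →
          L (fun x => a (k • x)) = fun x => L a (k • x)) → False) ∧
      (∀ (i : I) (c : Fin n) (j : Fin (m i c)) (k : ℂ ≃+* ℂ) (a : (Σ i, (K i →+* ℂ)) → ℚ), a ∈ Ar c →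
        ι i c j (fun x => a (k • x)) = fun s => ι i c j a (k • s)) ∧
      (∀ (i : I) (c : Fin n) (f : Fin (m i c) → ((Σ i, (K i →+* ℂ)) → ℚ)), (∀ j, f j ∈ Ar c) →
        ∑ j, ι i c j (f j) = 0 → ∀ j, f j = 0) ∧
      (∀ i c j, b i c j ∈ Ar c) ∧
      (∀ i, antiVec (Φ i).1 (1 : ℂ ≃+* ℂ) = ∑ c, ∑ j, ι i c j (b i c j)) ∧
      (∀ c, a₀ c ∈ Ar c) ∧ (∀ c, a₀ c ≠ 0) ∧
      (∀ c, r c ≤ ∑ i, m i c) ∧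
      (∀ c, Module.finrank ℚ ↥(⨆ i, ⨆ j, (𝒟 c).map (LinearMap.applyₗ (b i c j))) =
        r c * Module.finrank ℚ ↥((𝒟 c).map (LinearMap.applyₗ (a₀ c)))) ∧
      CMAlgebra.cmFamilyRank Φ = (∑ c, r c * Module.finrank ℚ (Ar c)) + 1 := by
  haveI : ∀ i, Nonempty (K i →+* ℂ) := fun i => inferInstance
  exact IrrOdd.exists_isotypic_typeRank_sigmaType_eq_sum (G := ℂ ≃+* ℂ) (E := fun i => K i →+* ℂ)
    (Φ := fun i => (Φ i).1) fun i => isCMTypeWith_conj (Φ i)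

/-- **ADDITIVITY FOR EVERY PRODUCT OF CM ABELIAN VARIETIES, WITH NO INPUT BUT THE CM TYPES: `Hg(∏_i A_i) =
∏_i Hg(A_i)` (`cmFamilyRank Φ + |I| = Σ_i cmTypeRank Φ_i + 1`) IFF, for an isotypic decomposition of the type
vectors (which EXISTS), in every class `c` the D-spans `⨆_j 𝒟_c·b^i_{c,j}` (`i ∈ I`) are INDEPENDENT in `A_c`**
(gen 75 M5-CM + file E3). [cite: Gordon1999HodgeAVSurvey, §3 Theorem and 7.5–7.7]
[cite: Deligne1982HodgeCycles, I.5 (p. 53)] [cite: Lang2002, XVII §1 and §3] -/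
theorem exists_isotypic_cmFamilyRank_add_card_eq_iff [Nonempty I] (Φ : ∀ i, CMType (K i)) :
    ∃ (n : ℕ) (Ar : Fin n → Submodule ℚ ((Σ i, (K i →+* ℂ)) → ℚ))
      (𝒟 : Fin n → Submodule ℚ (((Σ i, (K i →+* ℂ)) → ℚ) →ₗ[ℚ] ((Σ i, (K i →+* ℂ)) → ℚ)))
      (m : I → Fin n → ℕ)
      (ι : ∀ (i : I) (c : Fin n), Fin (m i c) → (((Σ i, (K i →+* ℂ)) → ℚ) →ₗ[ℚ] ((K i →+* ℂ) → ℚ)))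
      (b : ∀ (i : I) (c : Fin n), Fin (m i c) → ((Σ i, (K i →+* ℂ)) → ℚ)),
      (∀ (c : Fin n) (L : ((Σ i, (K i →+* ℂ)) → ℚ) →ₗ[ℚ] ((Σ i, (K i →+* ℂ)) → ℚ)), L ∈ 𝒟 c ↔
        (∀ a ∈ Ar c, L a ∈ Ar c) ∧ ∀ (k : ℂ ≃+* ℂ) (a : (Σ i, (K i →+* ℂ)) → ℚ), a ∈ Ar c →
          L (fun x => a (k • x)) = fun x => L a (k • x)) ∧
      (∀ (c : Fin n) (k : ℂ ≃+* ℂ) (a : (Σ i, (K i →+* ℂ)) → ℚ), a ∈ Ar c → (fun x => a (k • x)) ∈ Ar c) ∧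
      (∀ (c : Fin n) (W : Submodule ℚ ((Σ i, (K i →+* ℂ)) → ℚ)), W ≤ Ar c → W ≠ ⊥ →
        (∀ (k : ℂ ≃+* ℂ) (f : (Σ i, (K i →+* ℂ)) → ℚ), f ∈ W → (fun x => f (k • x)) ∈ W) → W = Ar c) ∧
      (∀ c : Fin n, Ar c ≠ ⊥) ∧
      (∀ (c c' : Fin n) (L : ((Σ i, (K i →+* ℂ)) → ℚ) →ₗ[ℚ] ((Σ i, (K i →+* ℂ)) → ℚ)), c ≠ c' → Ar c ≠ ⊥ →
        (∀ a ∈ Ar c, L a ∈ Ar c') → (∀ a ∈ Ar c, L a = 0 → a = 0) →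
        (∀ (k : ℂ ≃+* ℂ) (a : (Σ i, (K i →+* ℂ)) → ℚ), a ∈ Ar c →
          L (fun x => a (k • x)) = fun x => L a (k • x)) → False) ∧
      (∀ (i : I) (c : Fin n) (j : Fin (m i c)) (k : ℂ ≃+* ℂ) (a : (Σ i, (K i →+* ℂ)) → ℚ), a ∈ Ar c →
        ι i c j (fun x => a (k • x)) = fun s => ι i c j a (k • s)) ∧
      (∀ (i : I) (c : Fin n) (f : Fin (m i c) → ((Σ i, (K i →+* ℂ)) → ℚ)), (∀ j, f j ∈ Ar c) →
        ∑ j, ι i c j (f j) = 0 → ∀ j, f j = 0) ∧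
      (∀ i c j, b i c j ∈ Ar c) ∧
      (∀ i, antiVec (Φ i).1 (1 : ℂ ≃+* ℂ) = ∑ c, ∑ j, ι i c j (b i c j)) ∧
      (CMAlgebra.cmFamilyRank Φ + Fintype.card I = (∑ i, cmTypeRank (Φ i)) + 1 ↔
        ∀ c, iSupIndep fun i => ⨆ j, (𝒟 c).map (LinearMap.applyₗ (b i c j))) := by
  haveI : ∀ i, Nonempty (K i →+* ℂ) := fun i => inferInstance
  exact IrrOdd.exists_isotypic_typeRank_sigmaType_add_card_eq_iff (G := ℂ ≃+* ℂ) (E := fun i => K i →+* ℂ)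
    (Φ := fun i => (Φ i).1) fun i => isCMTypeWith_conj (Φ i)

/-- **SUB-PRODUCT DOMINATION FOR EVERY PRODUCT OF CM ABELIAN VARIETIES, WITH NO INPUT BUT THE CM TYPES** (`T ⊆ I`
non-empty): for an isotypic decomposition of the type vectors (which EXISTS), **`dim MT(∏_I A_i) = dim MT(∏_T A_i)
⟺ ∀ c ∀ i, ⨆_j 𝒟_c·b^i_{c,j} ≤ ⨆_{t∈T} ⨆_j 𝒟_c·b^t_{c,j}`** (gen 75 M5 + file E3, `κ = Subtype.val`).
[cite: Deligne1982HodgeCycles, I.5 (p. 53)] [cite: Gordon1999HodgeAVSurvey, 7.5–7.7] [cite: Lang2002, XVII §3] -/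
theorem exists_isotypic_cmFamilyRank_eq_restrict_iff (Φ : ∀ i, CMType (K i)) (T : Finset I) (hT : T.Nonempty) :
    ∃ (n : ℕ) (Ar : Fin n → Submodule ℚ ((Σ i, (K i →+* ℂ)) → ℚ))
      (𝒟 : Fin n → Submodule ℚ (((Σ i, (K i →+* ℂ)) → ℚ) →ₗ[ℚ] ((Σ i, (K i →+* ℂ)) → ℚ)))
      (m : I → Fin n → ℕ)
      (ι : ∀ (i : I) (c : Fin n), Fin (m i c) → (((Σ i, (K i →+* ℂ)) → ℚ) →ₗ[ℚ] ((K i →+* ℂ) → ℚ)))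
      (b : ∀ (i : I) (c : Fin n), Fin (m i c) → ((Σ i, (K i →+* ℂ)) → ℚ)),
      (∀ (c : Fin n) (L : ((Σ i, (K i →+* ℂ)) → ℚ) →ₗ[ℚ] ((Σ i, (K i →+* ℂ)) → ℚ)), L ∈ 𝒟 c ↔
        (∀ a ∈ Ar c, L a ∈ Ar c) ∧ ∀ (k : ℂ ≃+* ℂ) (a : (Σ i, (K i →+* ℂ)) → ℚ), a ∈ Ar c →
          L (fun x => a (k • x)) = fun x => L a (k • x)) ∧
      (∀ (c : Fin n) (k : ℂ ≃+* ℂ) (a : (Σ i, (K i →+* ℂ)) → ℚ), a ∈ Ar c → (fun x => a (k • x)) ∈ Ar c) ∧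
      (∀ (c : Fin n) (W : Submodule ℚ ((Σ i, (K i →+* ℂ)) → ℚ)), W ≤ Ar c → W ≠ ⊥ →
        (∀ (k : ℂ ≃+* ℂ) (f : (Σ i, (K i →+* ℂ)) → ℚ), f ∈ W → (fun x => f (k • x)) ∈ W) → W = Ar c) ∧
      (∀ c : Fin n, Ar c ≠ ⊥) ∧
      (∀ (c c' : Fin n) (L : ((Σ i, (K i →+* ℂ)) → ℚ) →ₗ[ℚ] ((Σ i, (K i →+* ℂ)) → ℚ)), c ≠ c' → Ar c ≠ ⊥ →
        (∀ a ∈ Ar c, L a ∈ Ar c') → (∀ a ∈ Ar c, L a = 0 → a = 0) →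
        (∀ (k : ℂ ≃+* ℂ) (a : (Σ i, (K i →+* ℂ)) → ℚ), a ∈ Ar c →
          L (fun x => a (k • x)) = fun x => L a (k • x)) → False) ∧
      (∀ (i : I) (c : Fin n) (j : Fin (m i c)) (k : ℂ ≃+* ℂ) (a : (Σ i, (K i →+* ℂ)) → ℚ), a ∈ Ar c →
        ι i c j (fun x => a (k • x)) = fun s => ι i c j a (k • s)) ∧
      (∀ (i : I) (c : Fin n) (f : Fin (m i c) → ((Σ i, (K i →+* ℂ)) → ℚ)), (∀ j, f j ∈ Ar c) →
        ∑ j, ι i c j (f j) = 0 → ∀ j, f j = 0) ∧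
      (∀ i c j, b i c j ∈ Ar c) ∧
      (∀ i, antiVec (Φ i).1 (1 : ℂ ≃+* ℂ) = ∑ c, ∑ j, ι i c j (b i c j)) ∧
      (CMAlgebra.cmFamilyRank Φ = CMAlgebra.cmFamilyRank (fun t : T => Φ t.1) ↔
        ∀ c i, (⨆ j, (𝒟 c).map (LinearMap.applyₗ (b i c j))) ≤
          ⨆ t : T, ⨆ j, (𝒟 c).map (LinearMap.applyₗ (b t.1 c j))) := by
  haveI : ∀ i, Nonempty (K i →+* ℂ) := fun i => inferInstance
  haveI : Nonempty T := hT.coe_sort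
  exact IrrOdd.exists_isotypic_typeRank_sigmaType_eq_reindex_iff (G := ℂ ≃+* ℂ) (E := fun i => K i →+* ℂ)
    (Φ := fun i => (Φ i).1) (fun i => isCMTypeWith_conj (Φ i)) (I' := T) (fun t : T => t.1)

end Summit.HodgeConjecture.CorCM

end
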